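import Summits.QuantumFields.BalabanUV.T4Continuum.Support.NE7ExpansionSegmentLettersCurved
import Summits.QuantumFields.BalabanUV.T4Continuum.Support.NE7CubicVertexCurved
import Summits.QuantumFields.BalabanUV.T4Continuum.Support.NE7CovariantByParts
import Summits.QuantumFields.BalabanUV.T4Continuum.Support.NE7ExpansionStructure
import Summits.QuantumFields.BalabanUV.T4Continuum.Support.NE7ExpansionRemainderCurvedWeak
import HarnessLib

/-!
# NE7ExpansionRemainderCurvedStrong — THE STRONG EXPANSION LETTER (hEXP) OF THE CURVED (APE) SKELETON AT A SMALL-FIELD BACKGROUND `W`, IN KERNEL: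
# `|dAction (We^{A}) Y − dAction W Y − hess W A Y| ≤ ρ_W·‖Y‖_{ℓ¹}`, `ρ_W = #Plane·(2c_loc + 64α₀α₁ + 1024xα₀²)`,
# `c_loc = 240δα₀(2α₁+24α₀δ+x) + 8α₀(2α₁+24α₀δ) + 6δ(2α₁+24δα₀) + (2α₁+24δα₀)(2α₁+24α₀δ) + 960δα₀² + 32xα₀²` — every term `O(M⁻³)` in the currencies
# `α₀ = α̂∕M`, `α₁ = α̂₁∕M²`, `x = b∕M²`: the curved twin of F48b, closing (L5) of `t4/b2b-balaban-t4-ne7-p1-g75/CURVED-APE-ROAD.md`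

Cell `pub-balaban`, rung (B)+1 sub-cell t4, lineage `b2b-balaban-t4-ne7-p1` (CRUX PROVER NE7 #1 = OWNER of row NE7), generation 75.  File F65 = the assembly over F61
`NE7CovariantByParts` (covariant by parts), F63 `NE7CubicVertexCurved` (covariant adjacent differences of the cubic vertex `𝒬_W(A)`), F64 `NE7ExpansionSegmentLettersCurved`
(segment letters; covariant curl `≤ 2α₁`), F45 `NE7ExpansionStructure` (the two-channel split at general backgrounds `hessPlaqAt_sub_hessPlaqAt_eq`, the mean-value reduction
`abs_dAction_vary_sub_hess_le`), F47, F48a's window sum.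

THE DIFFERENCE FROM THE FLAT CASE (F48b).  At a curved `W` the first channel of F45's split does not lose its `V₀`-term (`W(∂p′) ≠ 1`): it contributes
`Re tr[(dcurl₁ − dcurl₀)(hol₁ − 1)] + Re tr[dcurl₀(hol₁ − hol₀)]`, both products of two small letters because `‖hol₁ − hol₀‖ ≤ 2α₁ + 24α₀δ` (F64: the covariant curl is
`≤ 2α₁`) and `‖hol₀ − 1‖ ≤ x`; in the second channel `a b hh − a₀ b₀ hh₀ = (a−a₀) b hh + a₀ b (hh − hh₀) + a₀ (b − b₀ − q) hh₀ + a₀ q (hh₀ − 1) + a₀ q` (`q = s·𝒬_W(A)`), and the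
last term — the cubic vertex `Re tr[(d_W Y)·s𝒬_W(A)]` — is moved onto `Y` by F61 at the cost of F63's covariant adjacent differences `64α₀α₁ + 1024xα₀²`.

WHAT ([folklore] lattice calculus; 0 def, 0 sorry; `W` unitary `P`-periodic with `SmallField W x`; `A` skew `P`-periodic with `‖A‖ ≤ α₀` and the FORWARD covariant gradient
letter `‖Ad_{W(y+e_κ,τ)}A(y+e_τ,κ) − A(y,κ)‖ ≤ α₁`; `Y` `P`-periodic):
§2 **`abs_hessPlaqAt_vary_sub_add_le_W`** (per plaquette: `|hessPlaqAt V_s A Y − hessPlaqAt W A Y + Re tr[(d_W Y)·q]| ≤ c_loc·bl₁(Y)`);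
§3 **`abs_hess_vary_sub_hess_le_W_strong`** (window); §4 **`abs_dAction_vary_sub_dAction_sub_hess_le_W_strong`** — F55's (hEXP) with `ρ_W` above;
the currency clause `ρ_W ≤ ρ̂_W∕M³` is the companion `NE7ExpansionRemainderCurvedCurrency.rhoW_strong_currency`.
HONEST FRAMING (page 1): lattice calculus on OUR objects; `α₁` (the (1.36)₂-type gradient member of the representative) and the background's two radii are HYPOTHESES;
nothing of Bałaban's asserted; (APE) on curved data NOT proved (letters (L1), (L2), (L4) of the road remain); NOT ONE-STEP, NOT NE7; spine 0∕9; finite T⁴ rung (B)+1 —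
NOT infinite volume, NOT mass gap, NOT `BetaPertH`, NOT Clay.  Continuum YM on T⁴ ⇐ BetaPertH ∧ nine spine estimates (0/9 proved); BetaPertH ⇐ (D1) ∧ (D4) ∧ CAP+tail;
G-an2-4 gates asym, D1 and NE2/3/4.
-/

set_option autoImplicit false

open scoped BigOperators Matrix.Norms.L2Operator
open NormedSpace Finset Set

namespace Summit.QuantumFields.BalabanUV.T4Continuum.NE7ExpansionRemainderCurvedStrong

open Literature.MathematicalPhysics.QuantumFieldTheory.Balaban1983to89
open B7Prop1Explicit B7Prop2Explicit MatrixLog UnitaryModel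
open T4AveragingDeficitWall (Ad IsUnitaryCfg IsSkewDir SmallField curlAt vary dirL1 vary_zero)
open T4AveragingDeficitWallBoundary (IsPeriodicCfg periodBox)
open AveragingDeficitPeriodicCounting (IsPeriodicDir)
open AveragingDeficitTransport (mem_U1_of_unitary norm_Ad_of_unitary)
open AveragingDeficitPlaqDeriv (vary_isUnitaryCfg)
open AveragingDeficitNearIdentity (abs_nReTr_mul_le)
open MinimalActionLevels (perWin)
open NE3HessForm (hess hessPlaq hessPlaqAt dcurlAt dAction)
open NE3HessContinuity (bondL1At bondL1At_nonneg norm_dcurlAt_le)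
open NE3CurlStability (norm_curlAt_vary_sub_le)
open NE3EnergyHessBilin (Ad_real_smul)
open NE7CubicVertexLetters (bondL1At_le_of_sup)
open NE7DcurlBaseLipschitz (norm_dcurlAt_sub_dcurlAt_le)
open NE7ExpansionStructure (abs_dAction_vary_sub_hess_le hessPlaqAt_sub_hessPlaqAt_eq)
open NE7ExpansionSegmentLetters (sum_perWin_bondL1At_le)
open NE7ExpansionRemainderCurvedWeak (norm_curlAt_le_bondL1At)
open NE7ExpansionSegmentLettersCurved (norm_curlAt_le_of_covGrad covGrad_backward_of_forward norm_vary_sub_le_W norm_curlAt_vary_le_W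
  norm_hol_vary_sub_hol_le_W norm_curlAt_vary_taylor_le_W dcurlAt_self_periodic_W)
open NE7CubicVertexCurved (norm_dcurlAt_self_le norm_cubicVertex_covDiff₁_le norm_cubicVertex_covDiff₂_le)
open NE7CovariantByParts (abs_sum_nReTr_curlAt_mul_le_W)

noncomputable section

variable {d : ℕ} {n : Type*} [Fintype n] [DecidableEq n]

/-! ## §1 (A real scalar passes through a transport: row NE3's `NE3EnergyHessBilin.Ad_real_smul`, BY NAME.) -/

/-! ## §2 One plaquette: the two channels at a curved background, the cubic vertex kept explicit -/

/-- **PER PLAQUETTE AT A CURVED BACKGROUND** (statement in the module docstring): for `μ ≠ ν`, `s ∈ [0,1]`,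
`|hessPlaqAt (We^{sA}) A Y p′ − hessPlaqAt W A Y p′ + Re tr[(d_W Y)(p′)·s𝒬_W(A)(p′)]∕N| ≤ c_loc·bl₁(Y)(p′)`. [folklore] -/
theorem abs_hessPlaqAt_vary_sub_add_le_W [Nonempty n] {W : Site d → Fin d → (Matrix n n ℂ)ˣ} (hW : IsUnitaryCfg W) {x : ℝ} (hWx : SmallField W x)
    {A : Site d → Fin d → Matrix n n ℂ} (hA : IsSkewDir A) {α₀ α₁ : ℝ} (hAα : ∀ y κ, ‖A y κ‖ ≤ α₀)
    (hA1 : ∀ (y : Site d) (κ τ : Fin d), ‖Ad (W (y + e κ) τ) (A (y + e τ) κ) - A y κ‖ ≤ α₁)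
    (Y : Site d → Fin d → Matrix n n ℂ) {s : ℝ} (hs : s ∈ Icc (0 : ℝ) 1) (z : Site d) {μ ν : Fin d} (hμν : μ ≠ ν) :
    |hessPlaqAt (vary W A s) A Y z μ ν - hessPlaqAt W A Y z μ ν + nReTr (curlAt W Y z μ ν * (s • dcurlAt W A A z μ ν))|
      ≤ (240 * (Real.exp α₀ - 1) * α₀ * (2 * α₁ + 24 * α₀ * (Real.exp α₀ - 1) + x) + 8 * α₀ * (2 * α₁ + 24 * α₀ * (Real.exp α₀ - 1))
          + 6 * (Real.exp α₀ - 1) * (2 * α₁ + 24 * (Real.exp α₀ - 1) * α₀)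
          + (2 * α₁ + 24 * (Real.exp α₀ - 1) * α₀) * (2 * α₁ + 24 * α₀ * (Real.exp α₀ - 1))
          + 960 * (Real.exp α₀ - 1) * α₀ ^ 2 + 32 * x * α₀ ^ 2)
        * bondL1At Y z μ ν := by
  have hα : 0 ≤ α₀ := (norm_nonneg _).trans (hAα z μ)
  have hα1 : 0 ≤ α₁ := (norm_nonneg _).trans (hA1 z μ μ)
  have hx : 0 ≤ x := (norm_nonneg _).trans (hWx z μ ν hμν)
  -- the letters
  have hVsu : IsUnitaryCfg (vary W A s) := vary_isUnitaryCfg hW hA s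
  have lb := norm_curlAt_vary_le_W hW hA hAα hA1 hs z μ ν
  have lhh := norm_hol_vary_sub_hol_le_W hW hA hAα hA1 hs z μ ν
  have lt := norm_curlAt_vary_taylor_le_W hW hA hAα hs z μ ν
  have la' := norm_curlAt_vary_sub_le hW hA hAα s Y z μ ν
  have la₀' := norm_curlAt_le_bondL1At hW Y z μ ν
  have ldc' := norm_dcurlAt_le hVsu A Y z μ ν
  have ldc₀' := norm_dcurlAt_le hW A Y z μ ν
  have hl := fun y κ => norm_vary_sub_le_W hW hAα hs y κ
  have lddc' := norm_dcurlAt_sub_dcurlAt_le hW hVsu A Y z μ ν (hl z μ) (hl (z + e μ) ν) (hl (z + e ν) μ)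
  have lq' := norm_dcurlAt_self_le hW hAα z μ ν
  have lh : ‖((hol (vary W A s) z (plaqWord μ ν) : (Matrix n n ℂ)ˣ) : Matrix n n ℂ)‖ ≤ 1 :=
    (mem_U1_of_unitary (hol_mem_of (S := unitaryUnits (Matrix n n ℂ)) (fun y κ => hVsu y κ) z (plaqWord μ ν))).1
  have lh₀ : ‖((hol W z (plaqWord μ ν) : (Matrix n n ℂ)ˣ) : Matrix n n ℂ)‖ ≤ 1 :=
    (mem_U1_of_unitary (hol_mem_of (S := unitaryUnits (Matrix n n ℂ)) (fun y κ => hW y κ) z (plaqWord μ ν))).1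
  have lh₀1 : ‖((hol W z (plaqWord μ ν) : (Matrix n n ℂ)ˣ) : Matrix n n ℂ) - 1‖ ≤ x := hWx z μ ν hμν
  -- F45's split at a general background
  have hsplit := hessPlaqAt_sub_hessPlaqAt_eq (vary W A s) W A Y z μ ν
  -- abbreviations
  set δ : ℝ := Real.exp α₀ - 1 with hδdef
  have hδ : 0 ≤ δ := by rw [hδdef]; linarith [Real.one_le_exp hα]
  set a : Matrix n n ℂ := curlAt (vary W A s) Y z μ ν
  set a₀ : Matrix n n ℂ := curlAt W Y z μ ν
  set b : Matrix n n ℂ := curlAt (vary W A s) A z μ ν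
  set b₀ : Matrix n n ℂ := curlAt W A z μ ν
  set hh : Matrix n n ℂ := ((hol (vary W A s) z (plaqWord μ ν) : (Matrix n n ℂ)ˣ) : Matrix n n ℂ)
  set hh₀ : Matrix n n ℂ := ((hol W z (plaqWord μ ν) : (Matrix n n ℂ)ˣ) : Matrix n n ℂ)
  set q : Matrix n n ℂ := s • dcurlAt W A A z μ ν
  set dc : Matrix n n ℂ := dcurlAt (vary W A s) A Y z μ ν
  set dc₀ : Matrix n n ℂ := dcurlAt W A Y z μ ν
  -- sizes
  have lY : 0 ≤ bondL1At Y z μ ν := bondL1At_nonneg Y z μ ν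
  have hbA : bondL1At A z μ ν ≤ 4 * α₀ := bondL1At_le_of_sup hAα z μ ν
  have hbA0 : 0 ≤ bondL1At A z μ ν := bondL1At_nonneg A z μ ν
  have la : ‖a - a₀‖ ≤ 6 * δ * bondL1At Y z μ ν := by
    have hs1 : |s| ≤ 1 := abs_le.mpr ⟨by linarith [hs.1], hs.2⟩
    have hexp : Real.exp (|s| * α₀) - 1 ≤ δ := by
      have : |s| * α₀ ≤ α₀ := by nlinarith
      rw [hδdef]; linarith [Real.exp_le_exp.mpr this]
    exact la'.trans (mul_le_mul_of_nonneg_right (mul_le_mul_of_nonneg_left hexp (by norm_num)) lY)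
  have la₀ : ‖a₀‖ ≤ bondL1At Y z μ ν := la₀'
  have ldc : ‖dc‖ ≤ 8 * α₀ * bondL1At Y z μ ν := by
    calc ‖dc‖ ≤ 2 * (bondL1At A z μ ν * bondL1At Y z μ ν) := ldc'
      _ ≤ 2 * ((4 * α₀) * bondL1At Y z μ ν) := by nlinarith [mul_le_mul_of_nonneg_right hbA lY]
      _ = 8 * α₀ * bondL1At Y z μ ν := by ring
  have ldc₀ : ‖dc₀‖ ≤ 8 * α₀ * bondL1At Y z μ ν := by
    calc ‖dc₀‖ ≤ 2 * (bondL1At A z μ ν * bondL1At Y z μ ν) := ldc₀'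
      _ ≤ 2 * ((4 * α₀) * bondL1At Y z μ ν) := by nlinarith [mul_le_mul_of_nonneg_right hbA lY]
      _ = 8 * α₀ * bondL1At Y z μ ν := by ring
  have lddc : ‖dc - dc₀‖ ≤ 240 * δ * α₀ * bondL1At Y z μ ν := by
    calc ‖dc - dc₀‖ ≤ 60 * δ * (bondL1At A z μ ν * bondL1At Y z μ ν) := lddc'
      _ ≤ 60 * δ * ((4 * α₀) * bondL1At Y z μ ν) := mul_le_mul_of_nonneg_left (mul_le_mul_of_nonneg_right hbA lY) (by positivity)
      _ = 240 * δ * α₀ * bondL1At Y z μ ν := by ring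
  have lq : ‖q‖ ≤ 32 * α₀ ^ 2 := by
    have hs1 : |s| ≤ 1 := abs_le.mpr ⟨by linarith [hs.1], hs.2⟩
    calc ‖q‖ = |s| * ‖dcurlAt W A A z μ ν‖ := by rw [norm_smul, Real.norm_eq_abs]
      _ ≤ 1 * (32 * α₀ ^ 2) := mul_le_mul hs1 lq' (norm_nonneg _) zero_le_one
      _ = 32 * α₀ ^ 2 := one_mul _
  have lhh1 : ‖hh - 1‖ ≤ 2 * α₁ + 24 * α₀ * δ + x := by
    calc ‖hh - 1‖ = ‖(hh - hh₀) + (hh₀ - 1)‖ := by rw [sub_add_sub_cancel]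
      _ ≤ ‖hh - hh₀‖ + ‖hh₀ - 1‖ := norm_add_le _ _
      _ ≤ (2 * α₁ + 24 * α₀ * δ) + x := add_le_add lhh lh₀1
  have hB : 0 ≤ 2 * α₁ + 24 * δ * α₀ := by positivity
  have hB' : 0 ≤ 2 * α₁ + 24 * α₀ * δ := by positivity
  -- channel 1: `Re tr[dc (hh−1)] − Re tr[dc₀ (hh₀−1)] = Re tr[(dc−dc₀)(hh−1)] + Re tr[dc₀(hh−hh₀)]`
  have e1 : dc * (hh - 1) - dc₀ * (hh₀ - 1) = (dc - dc₀) * (hh - 1) + dc₀ * (hh - hh₀) := by noncomm_ring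
  have c1 : nReTr (dc * (hh - 1)) - nReTr (dc₀ * (hh₀ - 1)) = nReTr ((dc - dc₀) * (hh - 1)) + nReTr (dc₀ * (hh - hh₀)) := by
    rw [← T4TiltOscillation.nReTr_sub, e1, T4TiltOscillation.nReTr_add]
  -- channel 2: `a b hh − a₀ b₀ hh₀ = (a−a₀) b hh + a₀ b (hh−hh₀) + a₀ (b−b₀−q) hh₀ + a₀ q (hh₀−1) + a₀ q`
  have e2 : a * b * hh - a₀ * b₀ * hh₀
      = (a - a₀) * b * hh + a₀ * b * (hh - hh₀) + a₀ * (b - b₀ - q) * hh₀ + a₀ * q * (hh₀ - 1) + a₀ * q := by noncomm_ring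
  have c2 : nReTr (a * b * hh) - nReTr (a₀ * b₀ * hh₀)
      = nReTr ((a - a₀) * b * hh) + nReTr (a₀ * b * (hh - hh₀)) + nReTr (a₀ * (b - b₀ - q) * hh₀) + nReTr (a₀ * q * (hh₀ - 1))
        + nReTr (a₀ * q) := by
    rw [← T4TiltOscillation.nReTr_sub, e2, T4TiltOscillation.nReTr_add, T4TiltOscillation.nReTr_add, T4TiltOscillation.nReTr_add,
      T4TiltOscillation.nReTr_add]
  have hgoal : hessPlaqAt (vary W A s) A Y z μ ν - hessPlaqAt W A Y z μ ν + nReTr (a₀ * q)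
      = -(nReTr ((dc - dc₀) * (hh - 1)) + nReTr (dc₀ * (hh - hh₀)))
        - (nReTr ((a - a₀) * b * hh) + nReTr (a₀ * b * (hh - hh₀)) + nReTr (a₀ * (b - b₀ - q) * hh₀) + nReTr (a₀ * q * (hh₀ - 1))) := by
    rw [hsplit, c1, c2]; ring
  rw [hgoal]
  -- the six trace bounds
  have t1 : |nReTr ((dc - dc₀) * (hh - 1))| ≤ 240 * δ * α₀ * (2 * α₁ + 24 * α₀ * δ + x) * bondL1At Y z μ ν := by
    refine (abs_nReTr_mul_le _ _).trans ?_
    calc ‖dc - dc₀‖ * ‖hh - 1‖ ≤ (240 * δ * α₀ * bondL1At Y z μ ν) * (2 * α₁ + 24 * α₀ * δ + x) :=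
          mul_le_mul lddc lhh1 (norm_nonneg _) (by positivity)
      _ = _ := by ring
  have t2 : |nReTr (dc₀ * (hh - hh₀))| ≤ 8 * α₀ * (2 * α₁ + 24 * α₀ * δ) * bondL1At Y z μ ν := by
    refine (abs_nReTr_mul_le _ _).trans ?_
    calc ‖dc₀‖ * ‖hh - hh₀‖ ≤ (8 * α₀ * bondL1At Y z μ ν) * (2 * α₁ + 24 * α₀ * δ) := mul_le_mul ldc₀ lhh (norm_nonneg _) (by positivity)
      _ = _ := by ring
  have t3 : |nReTr ((a - a₀) * b * hh)| ≤ 6 * δ * (2 * α₁ + 24 * δ * α₀) * bondL1At Y z μ ν := by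
    refine (abs_nReTr_mul_le _ _).trans ?_
    have hab : ‖(a - a₀) * b‖ ≤ (6 * δ * bondL1At Y z μ ν) * (2 * α₁ + 24 * δ * α₀) :=
      (norm_mul_le _ _).trans (mul_le_mul la lb (norm_nonneg _) (by positivity))
    calc ‖(a - a₀) * b‖ * ‖hh‖ ≤ ((6 * δ * bondL1At Y z μ ν) * (2 * α₁ + 24 * δ * α₀)) * 1 :=
          mul_le_mul hab lh (norm_nonneg _) (by positivity)
      _ = _ := by ring
  have t4 : |nReTr (a₀ * b * (hh - hh₀))| ≤ (2 * α₁ + 24 * δ * α₀) * (2 * α₁ + 24 * α₀ * δ) * bondL1At Y z μ ν := by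
    refine (abs_nReTr_mul_le _ _).trans ?_
    have hab : ‖a₀ * b‖ ≤ bondL1At Y z μ ν * (2 * α₁ + 24 * δ * α₀) :=
      (norm_mul_le _ _).trans (mul_le_mul la₀ lb (norm_nonneg _) lY)
    calc ‖a₀ * b‖ * ‖hh - hh₀‖ ≤ (bondL1At Y z μ ν * (2 * α₁ + 24 * δ * α₀)) * (2 * α₁ + 24 * α₀ * δ) :=
          mul_le_mul hab lhh (norm_nonneg _) (by positivity)
      _ = _ := by ring
  have t5 : |nReTr (a₀ * (b - b₀ - q) * hh₀)| ≤ 960 * δ * α₀ ^ 2 * bondL1At Y z μ ν := by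
    refine (abs_nReTr_mul_le _ _).trans ?_
    have hab : ‖a₀ * (b - b₀ - q)‖ ≤ bondL1At Y z μ ν * (960 * δ * α₀ ^ 2) :=
      (norm_mul_le _ _).trans (mul_le_mul la₀ lt (norm_nonneg _) lY)
    calc ‖a₀ * (b - b₀ - q)‖ * ‖hh₀‖ ≤ (bondL1At Y z μ ν * (960 * δ * α₀ ^ 2)) * 1 := mul_le_mul hab lh₀ (norm_nonneg _) (by positivity)
      _ = _ := by ring
  have t6 : |nReTr (a₀ * q * (hh₀ - 1))| ≤ 32 * x * α₀ ^ 2 * bondL1At Y z μ ν := by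
    refine (abs_nReTr_mul_le _ _).trans ?_
    have hab : ‖a₀ * q‖ ≤ bondL1At Y z μ ν * (32 * α₀ ^ 2) := (norm_mul_le _ _).trans (mul_le_mul la₀ lq (norm_nonneg _) lY)
    calc ‖a₀ * q‖ * ‖hh₀ - 1‖ ≤ (bondL1At Y z μ ν * (32 * α₀ ^ 2)) * x := mul_le_mul hab lh₀1 (norm_nonneg _) (by positivity)
      _ = _ := by ring
  have habs : |-(nReTr ((dc - dc₀) * (hh - 1)) + nReTr (dc₀ * (hh - hh₀)))
        - (nReTr ((a - a₀) * b * hh) + nReTr (a₀ * b * (hh - hh₀)) + nReTr (a₀ * (b - b₀ - q) * hh₀) + nReTr (a₀ * q * (hh₀ - 1)))|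
      ≤ (|nReTr ((dc - dc₀) * (hh - 1))| + |nReTr (dc₀ * (hh - hh₀))|)
        + (|nReTr ((a - a₀) * b * hh)| + |nReTr (a₀ * b * (hh - hh₀))| + |nReTr (a₀ * (b - b₀ - q) * hh₀)| + |nReTr (a₀ * q * (hh₀ - 1))|) := by
    refine (abs_sub _ _).trans (add_le_add ?_ ?_)
    · rw [abs_neg]; exact abs_add_le _ _
    · exact (abs_add_le _ _).trans (add_le_add ((abs_add_le _ _).trans (add_le_add (abs_add_le _ _) le_rfl)) le_rfl)
  refine habs.trans ?_
  have := add_le_add (add_le_add t1 t2) (add_le_add (add_le_add (add_le_add t3 t4) t5) t6)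
  refine this.trans (le_of_eq ?_)
  ring

/-! ## §3 The window sum, with the cubic vertex by parts -/

/-- **`|hess (We^{sA}) A Y (perWin d P) − hess W A Y (perWin d P)| ≤ ρ_W·‖Y‖_{ℓ¹(periodBox P)}`**, `ρ_W = #Plane·(2c_loc + 64α₀α₁ + 1024xα₀²)`: §2 per plaquette, the
window sum of `bl₁(Y)`, and F61's by-parts letter for `G := s·𝒬_W(A)` with F63's covariant differences (`|s| ≤ 1`). [folklore] -/
theorem abs_hess_vary_sub_hess_le_W_strong [Nonempty n] {P : ℕ} (hP : 1 ≤ P) {W : Site d → Fin d → (Matrix n n ℂ)ˣ} (hW : IsUnitaryCfg W)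
    (hWP : IsPeriodicCfg W (P : ℤ)) {x : ℝ} (hx : 0 ≤ x) (hWx : SmallField W x)
    {A : Site d → Fin d → Matrix n n ℂ} (hA : IsSkewDir A) (hAP : IsPeriodicDir A (P : ℤ)) {α₀ α₁ : ℝ} (hα₀ : 0 ≤ α₀) (hα₁ : 0 ≤ α₁)
    (hAα : ∀ y κ, ‖A y κ‖ ≤ α₀) (hA1 : ∀ (y : Site d) (κ τ : Fin d), ‖Ad (W (y + e κ) τ) (A (y + e τ) κ) - A y κ‖ ≤ α₁)
    {Y : Site d → Fin d → Matrix n n ℂ} (hYP : IsPeriodicDir Y (P : ℤ)) {s : ℝ} (hs : s ∈ Icc (0 : ℝ) 1) :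
    |hess (vary W A s) A Y (perWin d P) - hess W A Y (perWin d P)|
      ≤ (Fintype.card (T4AveragingDeficitWall.Plane d) : ℝ)
          * (2 * (240 * (Real.exp α₀ - 1) * α₀ * (2 * α₁ + 24 * α₀ * (Real.exp α₀ - 1) + x) + 8 * α₀ * (2 * α₁ + 24 * α₀ * (Real.exp α₀ - 1))
              + 6 * (Real.exp α₀ - 1) * (2 * α₁ + 24 * (Real.exp α₀ - 1) * α₀)
              + (2 * α₁ + 24 * (Real.exp α₀ - 1) * α₀) * (2 * α₁ + 24 * α₀ * (Real.exp α₀ - 1))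
              + 960 * (Real.exp α₀ - 1) * α₀ ^ 2 + 32 * x * α₀ ^ 2)
            + (64 * α₀ * α₁ + 1024 * x * α₀ ^ 2))
        * dirL1 Y (periodBox (d := d) P) := by
  -- the per-plaquette letters
  have hEp' := fun (p : T4AveragingDeficitWall.Plaq d) => abs_hessPlaqAt_vary_sub_add_le_W hW hWx hA hAα hA1 Y hs p.1 (ne_of_lt p.2.2)
  set δ : ℝ := Real.exp α₀ - 1 with hδdef
  have hδ : 0 ≤ δ := by rw [hδdef]; linarith [Real.one_le_exp hα₀]
  set cloc : ℝ := 240 * δ * α₀ * (2 * α₁ + 24 * α₀ * δ + x) + 8 * α₀ * (2 * α₁ + 24 * α₀ * δ)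
    + 6 * δ * (2 * α₁ + 24 * δ * α₀) + (2 * α₁ + 24 * δ * α₀) * (2 * α₁ + 24 * α₀ * δ) + 960 * δ * α₀ ^ 2 + 32 * x * α₀ ^ 2 with hcloc
  have hcloc0 : 0 ≤ cloc := by rw [hcloc]; positivity
  set G : Site d → Fin d → Fin d → Matrix n n ℂ := fun z μ ν => s • dcurlAt W A A z μ ν with hG
  set E : T4AveragingDeficitWall.Plaq d → ℝ := fun p =>
    hessPlaqAt (vary W A s) A Y p.1 p.2.1.1 p.2.1.2 - hessPlaqAt W A Y p.1 p.2.1.1 p.2.1.2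
      + nReTr (curlAt W Y p.1 p.2.1.1 p.2.1.2 * G p.1 p.2.1.1 p.2.1.2) with hE
  have hdecomp : hess (vary W A s) A Y (perWin d P) - hess W A Y (perWin d P)
      = ∑ p ∈ perWin d P, E p - ∑ p ∈ perWin d P, nReTr (curlAt W Y p.1 p.2.1.1 p.2.1.2 * G p.1 p.2.1.1 p.2.1.2) := by
    unfold hess
    rw [← Finset.sum_sub_distrib, ← Finset.sum_sub_distrib]
    refine Finset.sum_congr rfl fun p _ => ?_
    simp only [hE, hessPlaq]
    ring
  have hEp : ∀ p ∈ perWin d P, |E p| ≤ cloc * bondL1At Y p.1 p.2.1.1 p.2.1.2 := fun p _ => hEp' p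
  -- the by-parts letter: periodicity and the two covariant differences of `G`
  have hGP : ∀ (z : Site d) (κ μ ν : Fin d), G (z + (P : ℤ) • e κ) μ ν = G z μ ν := by
    intro z κ μ ν
    simp only [hG, dcurlAt_self_periodic_W hWP hAP z κ μ ν]
  have hs1 : |s| ≤ 1 := abs_le.mpr ⟨by linarith [hs.1], hs.2⟩
  have hA1b := covGrad_backward_of_forward hW hA1
  have hγ : 0 ≤ 64 * α₀ * α₁ + 1024 * x * α₀ ^ 2 := by positivity
  have hG₁ : ∀ (π : T4AveragingDeficitWall.Plane d) (z : Site d),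
      ‖Ad (W z π.1.1)⁻¹ (G z π.1.1 π.1.2)
          - Ad (W (z - e π.1.2) π.1.1 * W (z - e π.1.2 + e π.1.1) π.1.2)⁻¹ (G (z - e π.1.2) π.1.1 π.1.2)‖ ≤ 64 * α₀ * α₁ + 1024 * x * α₀ ^ 2 := by
    intro π z
    simp only [hG, Ad_real_smul, ← smul_sub, norm_smul, Real.norm_eq_abs]
    have h := norm_cubicVertex_covDiff₁_le hW hx hWx hAα hA1b z (ne_of_lt π.2)
    calc |s| * _ ≤ 1 * (64 * α₀ * α₁ + 1024 * x * α₀ ^ 2) := mul_le_mul hs1 h (norm_nonneg _) zero_le_one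
      _ = _ := one_mul _
  have hG₂ : ∀ (π : T4AveragingDeficitWall.Plane d) (z : Site d),
      ‖Ad (W (z - e π.1.1) π.1.1 * W z π.1.2)⁻¹ (G (z - e π.1.1) π.1.1 π.1.2)
          - Ad (W z π.1.1 * W (z + e π.1.1) π.1.2 * (W (z + e π.1.2) π.1.1)⁻¹)⁻¹ (G z π.1.1 π.1.2)‖ ≤ 64 * α₀ * α₁ + 1024 * x * α₀ ^ 2 := by
    intro π z
    simp only [hG, Ad_real_smul, ← smul_sub, norm_smul, Real.norm_eq_abs]
    have h := norm_cubicVertex_covDiff₂_le hW hx hWx hAα hA1b z (ne_of_lt π.2)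
    calc |s| * _ ≤ 1 * (64 * α₀ * α₁ + 1024 * x * α₀ ^ 2) := mul_le_mul hs1 h (norm_nonneg _) zero_le_one
      _ = _ := one_mul _
  have hparts := abs_sum_nReTr_curlAt_mul_le_W hP hWP hYP hGP hγ hG₁ hG₂
  have hwin := sum_perWin_bondL1At_le (n := n) hP hYP
  rw [hdecomp]
  refine (abs_sub _ _).trans ?_
  have hE1 : |∑ p ∈ perWin d P, E p| ≤ cloc * (2 * (Fintype.card (T4AveragingDeficitWall.Plane d) : ℝ) * dirL1 Y (periodBox (d := d) P)) := by
    refine (Finset.abs_sum_le_sum_abs _ _).trans ?_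
    refine (Finset.sum_le_sum hEp).trans ?_
    rw [← Finset.mul_sum]
    exact mul_le_mul_of_nonneg_left hwin hcloc0
  have := add_le_add hE1 hparts
  refine this.trans (le_of_eq ?_)
  rw [hcloc]; ring

/-! ## §4 THE STRONG (hEXP) LETTER OF F55 AT A CURVED BACKGROUND -/

/-- **THE STRONG EXPANSION LETTER AT A CURVED BACKGROUND** (statement and `ρ_W` in the module docstring): for `W` unitary `P`-periodic with `SmallField W x`, `A` skew
`P`-periodic with `‖A‖ ≤ α₀` and the forward covariant gradient letter `α₁`, and every `P`-periodic `Y`,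
`|dAction (We^{A}) Y (perWin d P) − dAction W Y (perWin d P) − hess W A Y (perWin d P)| ≤ ρ_W·dirL1 Y (periodBox P)`. [folklore] -/
theorem abs_dAction_vary_sub_dAction_sub_hess_le_W_strong [Nonempty n] {P : ℕ} (hP : 1 ≤ P) {W : Site d → Fin d → (Matrix n n ℂ)ˣ} (hW : IsUnitaryCfg W)
    (hWP : IsPeriodicCfg W (P : ℤ)) {x : ℝ} (hx : 0 ≤ x) (hWx : SmallField W x)
    {A : Site d → Fin d → Matrix n n ℂ} (hA : IsSkewDir A) (hAP : IsPeriodicDir A (P : ℤ)) {α₀ α₁ : ℝ} (hα₀ : 0 ≤ α₀) (hα₁ : 0 ≤ α₁)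
    (hAα : ∀ y κ, ‖A y κ‖ ≤ α₀) (hA1 : ∀ (y : Site d) (κ τ : Fin d), ‖Ad (W (y + e κ) τ) (A (y + e τ) κ) - A y κ‖ ≤ α₁)
    {Y : Site d → Fin d → Matrix n n ℂ} (hYP : IsPeriodicDir Y (P : ℤ)) :
    |dAction (vary W A 1) Y (perWin d P) - dAction W Y (perWin d P) - hess W A Y (perWin d P)|
      ≤ (Fintype.card (T4AveragingDeficitWall.Plane d) : ℝ)
          * (2 * (240 * (Real.exp α₀ - 1) * α₀ * (2 * α₁ + 24 * α₀ * (Real.exp α₀ - 1) + x) + 8 * α₀ * (2 * α₁ + 24 * α₀ * (Real.exp α₀ - 1))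
              + 6 * (Real.exp α₀ - 1) * (2 * α₁ + 24 * (Real.exp α₀ - 1) * α₀)
              + (2 * α₁ + 24 * (Real.exp α₀ - 1) * α₀) * (2 * α₁ + 24 * α₀ * (Real.exp α₀ - 1))
              + 960 * (Real.exp α₀ - 1) * α₀ ^ 2 + 32 * x * α₀ ^ 2)
            + (64 * α₀ * α₁ + 1024 * x * α₀ ^ 2))
        * dirL1 Y (periodBox (d := d) P) :=
  abs_dAction_vary_sub_hess_le W A Y (perWin d P) fun _ hs =>
    abs_hess_vary_sub_hess_le_W_strong hP hW hWP hx hWx hA hAP hα₀ hα₁ hAα hA1 hYP hs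

end

end Summit.QuantumFields.BalabanUV.T4Continuum.NE7ExpansionRemainderCurvedStrong
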